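import Summits.Ventures.PackingBounds.ThreePointCert.T16d11Agg1

/-!
# Tammes θ(16) ≤ arccos(374/625) = 53.2447° (A(3, 374/625) ≤ 15): kernel validation of Gram block R0 (chunks 3–4 of 6)

Framing: lottery ticket; floor = certified bounds/negative ranges. Venture `PackingBounds` (cell
`pub-packcert`), three-point SDP family. Integer data of a feasible point of the Bachoc–Vallentin
semidefinite program (n = 3, s = 374/625, degree d = 11, Bachoc–Vallentin
multiplier set = cell mode sym2), derived by `cert2lean_s2.py` (sdp gen 5 fork of cert2lean_lp.py) from the exact rational certificate
`sdp-n3-d11-s374-625-sym2f-lpclient-v1.json` of the cell (exact verifier #1 + verifier #2 of the other seat), in the units of the kernel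
checker `ThreePointCert.Check` + `CheckSym2` (soundness `card_le_of_cert3S2`); Gram factors offset-encoded for the
Kronecker-packed chunk validation `ThreePointCert.CheckKron` (emitter `emitleanS2.py` = lp gen 3 emitleanK.py). Generated file: plain
lists of integers / monomials.
-/

namespace Summit.Ventures.PackingBounds.ThreePointCert.T16d11

open Literature.Geometry.DiscreteGeometry Literature.Geometry.DiscreteGeometry.PolyCert PolyCert.SPoly

set_option maxRecDepth 100000 in
set_option maxHeartbeats 0 in
/-- Block `R0`: rows from 175 (61 rows) of `zᵀ(LLᵀ)z` added to `dR0c2` give `dR0c3` (kernel, Kronecker-packed chunk check). -/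
theorem okR0_3 : chunkOKK T16d11.gR0K 175 61 T16d11.dR0c2 T16d11.dR0c3 = true := by
  decide +kernel

set_option maxRecDepth 100000 in
set_option maxHeartbeats 0 in
/-- Block `R0`: rows from 236 (53 rows) of `zᵀ(LLᵀ)z` added to `dR0c3` give `dR0c4` (kernel, Kronecker-packed chunk check). -/
theorem okR0_4 : chunkOKK T16d11.gR0K 236 53 T16d11.dR0c3 T16d11.dR0c4 = true := by
  decide +kernel

end Summit.Ventures.PackingBounds.ThreePointCert.T16d11
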